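import Literature.Geometry.Riemannian.GaussianAreaGraphBound
import HarnessLib

/-!
# The entropy of a closed embedded submanifold with `λ > 1` is achieved (Colding–Minicozzi 2012, Lemma 7.7)

"**Lemma 7.7.** If `Σ ⊂ ℝⁿ⁺¹` is a smooth closed embedded hypersurface and `λ(Σ) > 1`, then there
exist `x₀ ∈ ℝⁿ⁺¹` and `t₀ > 0` so that `λ = F_{x₀,t₀}(Σ)`." We prove it for `Σ = f(M)`, `M` a
compact manifold with boundaryless model of dimension `n ≥ 1`, `f` an injective `C^m` map
(`m ≥ 1`) with everywhere injective differential into a finite-dimensional real inner product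
space (`exists_gaussianArea_eq_gaussianEntropy`). As in the printed proof, `F_{x₀,t₀}(Σ) < λ`
when `t₀` is large (`F ≤ (4πt₀)^{-n/2} 𝓗ⁿ(Σ)`, "uniformly in `x₀`"), when `x₀` is far from `Σ`
("by the exponential decay of the weight function together with the compactness of `Σ`"), and
when `t₀` is small, uniformly in `x₀` — here the printed proof combines property (3) of
Lemma 7.2 pointwise with the curvature bound (2) `∂_{t₀} F ≥ -λ sup H²/4`; we use instead the
curvature-free uniform bound `exists_forall_gaussianArea_range_le` of
`GaussianAreaGraphBound.lean` (finitely many graph pieces over tangent planes and Lipschitz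
comparison of Hausdorff measures), which is where `λ > 1` enters. On the remaining compact
region of `(x₀, t₀)` the continuous `F` (`continuousOn_gaussianArea`) attains a maximum, which
equals `λ`.

Everything is proved; no definitions and no named facts are introduced.

## References

* T. H. Colding, W. P. Minicozzi II, *Generic mean curvature flow I; generic singularities*,
  Ann. of Math. 175 (2012) 755–833, §7.1, Lemma 7.7. [ColdingMinicozzi2012]
-/

noncomputable section

open Set Function Filter Module Metric
open _root_.MeasureTheory _root_.MeasureTheory.Measure
open scoped ENNReal NNReal Topology Manifold

namespace Literature.Geometry.Riemannian

section Achieved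

variable {EM : Type*} [NormedAddCommGroup EM] [NormedSpace ℝ EM] [FiniteDimensional ℝ EM]
  {H : Type*} [TopologicalSpace H] {I : ModelWithCorners ℝ EM H} [I.Boundaryless]
  {M : Type*} [TopologicalSpace M] [ChartedSpace H M] [CompactSpace M]
  {F : Type*} [NormedAddCommGroup F] [InnerProductSpace ℝ F] [FiniteDimensional ℝ F]
  [MeasurableSpace F] [BorelSpace F]

/-- For `q > 1` there is `ε > 0` with `(1+ε)ⁿ + ε < q` (continuity at `ε = 0`). [folklore] -/
theorem exists_eps_pow_add_lt (n : ℕ) {q : ℝ} (hq : 1 < q) :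
    ∃ ε : ℝ, 0 < ε ∧ (1 + ε) ^ n + ε < q := by
  have hcts : ContinuousAt (fun ε : ℝ => (1 + ε) ^ n + ε) 0 := by fun_prop
  have h1 : ∀ᶠ ε : ℝ in 𝓝 0, (1 + ε) ^ n + ε < q := by
    have := hcts.tendsto
    simp only [add_zero, one_pow] at this
    exact this.eventually (gt_mem_nhds hq)
  have h2 : ∀ᶠ ε : ℝ in 𝓝[>] 0, (1 + ε) ^ n + ε < q := mem_nhdsWithin_of_mem_nhds h1
  obtain ⟨ε, hε1, hε⟩ := (h2.and self_mem_nhdsWithin).exists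
  exact ⟨ε, hε, hε1⟩

/-- **Colding–Minicozzi 2012, Lemma 7.7: the entropy is achieved for compact hypersurfaces with
`λ > 1`.** "If `Σ ⊂ ℝⁿ⁺¹` is a smooth closed embedded hypersurface and `λ(Σ) > 1`, then there exist
`x₀ ∈ ℝⁿ⁺¹` and `t₀ > 0` so that `λ = F_{x₀,t₀}(Σ)`." Here for `Σ = f(M)`, `M` compact
(boundaryless model of dimension `n ≥ 1`), `f` an injective `C^m` map (`m ≥ 1`) with everywhere
injective differential into a finite-dimensional inner product space. Structure of the printed
proof, with the small-scale step made curvature-free: the `F`-functionals are `< λ` when `t₀` is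
small (uniformly in `x₀`: `exists_forall_gaussianArea_range_le`, using `λ > 1`; the paper uses
Lemma 7.2 (2)–(3) here), when `t₀` is large (`F ≤ (4πt₀)^{-n/2} μHE[n](Σ)`), and when `x₀` is far
from the bounded set `Σ` (exponential decay of the weight, `gaussianArea_le_of_le_norm_sub`); on
the remaining compact set of `(x₀, t₀)` the continuous function `F` (`continuousOn_gaussianArea`)
attains its maximum, which is then `λ`. [cite: ColdingMinicozzi2012, Lemma 7.7] -/
theorem exists_gaussianArea_eq_gaussianEntropy {n : ℕ} (hn : finrank ℝ EM = n) (hn1 : 1 ≤ n)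
    {f : M → F} {m : WithTop ℕ∞} (hf : ContMDiff I 𝓘(ℝ, F) m f) (hm : 1 ≤ m) (hinj : Injective f)
    (hd : ∀ x, Injective (mfderiv I 𝓘(ℝ, F) f x))
    (hent : 1 < gaussianEntropy n (range f)) :
    ∃ (y₀ : F) (t₀ : ℝ), 0 < t₀ ∧ gaussianArea n y₀ t₀ (range f) = gaussianEntropy n (range f) := by
  have hK : IsCompact (range f) := isCompact_range hf.continuous
  have hΛ : (μHE[n] : Measure F) (range f) < ∞ :=
    MeasureTheory.Hausdorff.euclideanHausdorffMeasure_range_lt_top hf hm (hn ▸ le_rfl)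
  set lam := gaussianEntropy n (range f) with hlam
  -- a real threshold `q` with `1 < ofReal q < λ`
  obtain ⟨q, -, h1q, hqlam⟩ := ENNReal.lt_iff_exists_real_btwn.1 hent
  have hq1 : 1 < q := by
    have := ENNReal.one_lt_ofReal.1 h1q
    exact this
  -- (i) small scales, uniformly in the centre
  obtain ⟨ε, hε, hεq⟩ := exists_eps_pow_add_lt n hq1
  obtain ⟨ts, hts, hsmall⟩ := exists_forall_gaussianArea_range_le hn hf hm hinj hd hε
  have hsmall' : ∀ (y : F) (t : ℝ), 0 < t → t ≤ ts → gaussianArea n y t (range f) ≤ ENNReal.ofReal q := by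
    intro y t ht htt
    refine (hsmall y t ht htt).trans ?_
    rw [← ENNReal.ofReal_add (by positivity) hε.le]
    exact ENNReal.ofReal_le_ofReal hεq.le
  -- (ii) large scales, uniformly in the centre
  have hlarge_lim : Tendsto (fun t : ℝ => ENNReal.ofReal ((4 * Real.pi * t) ^ (-(n : ℝ) / 2)) *
      (μHE[n] : Measure F) (range f)) atTop (𝓝 0) := by
    have h1 : Tendsto (fun t : ℝ => (4 * Real.pi * t) ^ (-(n : ℝ) / 2)) atTop (𝓝 0) := by
      have h2 : Tendsto (fun t : ℝ => 4 * Real.pi * t) atTop atTop :=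
        Tendsto.const_mul_atTop (by positivity) tendsto_id
      have h3 := (tendsto_rpow_neg_atTop (y := (n : ℝ) / 2) (by positivity)).comp h2
      refine h3.congr fun t => ?_
      simp only [Function.comp_apply, neg_div]
    have h4 := ENNReal.tendsto_ofReal h1
    rw [ENNReal.ofReal_zero] at h4
    have h5 := ENNReal.Tendsto.mul_const h4 (Or.inr hΛ.ne)
    rwa [zero_mul] at h5
  have hqpos : (0 : ℝ≥0∞) < ENNReal.ofReal q := ENNReal.ofReal_pos.2 (by linarith)
  obtain ⟨tb₀, htb₀⟩ := (hlarge_lim.eventually (gt_mem_nhds hqpos)).exists_forall_of_atTop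
  set tb := max tb₀ (ts + 1) with htb
  have htb_ts : ts < tb := lt_of_lt_of_le (by linarith) (le_max_right _ _)
  have htbpos : 0 < tb := hts.trans htb_ts
  have hlarge : ∀ (y : F) (t : ℝ), tb ≤ t → gaussianArea n y t (range f) ≤ ENNReal.ofReal q := by
    intro y t htt
    have ht : 0 < t := htbpos.trans_le htt
    calc gaussianArea n y t (range f)
        ≤ gaussianNormalization n t * (μHE[n] : Measure F) (range f) := gaussianArea_le_mul_measure n y ht.le _
      _ ≤ ENNReal.ofReal q := (htb₀ t ((le_max_left _ _).trans htt)).le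
  -- (iii) far centres, for scales in `[ts, tb]`
  obtain ⟨ρ, hρ⟩ := hK.isBounded.subset_closedBall (0 : F)
  have hfar_lim : Tendsto (fun D : ℝ => ENNReal.ofReal ((4 * Real.pi * ts) ^ (-(n : ℝ) / 2) *
      Real.exp (-D ^ 2 / (4 * tb))) * (μHE[n] : Measure F) (range f)) atTop (𝓝 0) := by
    have h1 : Tendsto (fun D : ℝ => D ^ 2 / (4 * tb)) atTop atTop :=
      (tendsto_pow_atTop two_ne_zero).atTop_div_const (by positivity)
    have h2 : Tendsto (fun D : ℝ => Real.exp (-(D ^ 2 / (4 * tb)))) atTop (𝓝 0) :=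
      Real.tendsto_exp_neg_atTop_nhds_zero.comp h1
    have h3 := h2.const_mul ((4 * Real.pi * ts) ^ (-(n : ℝ) / 2))
    rw [mul_zero] at h3
    have h4 := ENNReal.tendsto_ofReal h3
    rw [ENNReal.ofReal_zero] at h4
    have h5 := ENNReal.Tendsto.mul_const h4 (Or.inr hΛ.ne)
    rw [zero_mul] at h5
    refine h5.congr fun D => ?_
    simp only [neg_div]
  obtain ⟨D₀, hD₀⟩ := (hfar_lim.eventually (gt_mem_nhds hqpos)).exists_forall_of_atTop
  set D := max D₀ 0 with hD
  have hfar : ∀ (y : F) (t : ℝ), ts ≤ t → t ≤ tb → ρ + D < ‖y‖ →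
      gaussianArea n y t (range f) ≤ ENNReal.ofReal q := by
    intro y t h1 h2 hy
    have ht : 0 < t := hts.trans_le h1
    have hdist : ∀ z ∈ range f, D ≤ ‖z - y‖ := by
      intro z hz
      have hzρ : ‖z‖ ≤ ρ := mem_closedBall_zero_iff.1 (hρ hz)
      have := norm_sub_norm_le y z
      rw [norm_sub_rev] at this
      linarith
    have hDnn : 0 ≤ D := le_max_right _ _
    calc gaussianArea n y t (range f)
        ≤ ENNReal.ofReal ((4 * Real.pi * t) ^ (-(n : ℝ) / 2) * Real.exp (-D ^ 2 / (4 * t))) *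
            (μHE[n] : Measure F) (range f) :=
          gaussianArea_le_of_le_norm_sub n y ht hK.isClosed.measurableSet hDnn hdist
      _ ≤ ENNReal.ofReal ((4 * Real.pi * ts) ^ (-(n : ℝ) / 2) * Real.exp (-D ^ 2 / (4 * tb))) *
            (μHE[n] : Measure F) (range f) := by
          refine mul_le_mul' (ENNReal.ofReal_le_ofReal ?_) le_rfl
          refine mul_le_mul ?_ ?_ (Real.exp_pos _).le (Real.rpow_nonneg (by positivity) _)
          · -- `(4πt)^{-n/2} ≤ (4π ts)^{-n/2}` for `ts ≤ t`
            rw [neg_div, Real.rpow_neg (by positivity), Real.rpow_neg (by positivity)]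
            refine inv_anti₀ (Real.rpow_pos_of_pos (by positivity) _) ?_
            exact Real.rpow_le_rpow (by positivity) (by nlinarith [Real.pi_pos]) (by positivity)
          · refine Real.exp_le_exp.2 ?_
            rw [neg_div, neg_div, neg_le_neg_iff]
            exact div_le_div_of_nonneg_left (by positivity) (by positivity) (by linarith)
      _ ≤ ENNReal.ofReal q := (hD₀ D (le_max_left _ _)).le
  -- the compact region and a maximiser of the continuous `F` on it
  set Kreg : Set (F × ℝ) := closedBall (0 : F) (ρ + D) ×ˢ Icc ts tb with hKreg
  have hKc : IsCompact Kreg := (isCompact_closedBall _ _).prod isCompact_Icc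
  have hcont : ContinuousOn (fun p : F × ℝ => gaussianArea n p.1 p.2 (range f)) Kreg := by
    refine (continuousOn_gaussianArea n hΛ).mono ?_
    rintro ⟨y, t⟩ ⟨-, ht⟩
    exact ⟨mem_univ _, hts.trans_le ht.1⟩
  obtain ⟨z₀, hz₀⟩ : (range f).Nonempty := by
    by_contra hempty
    rw [not_nonempty_iff_eq_empty] at hempty
    have hlam0 : lam = 0 := by rw [hlam, hempty, gaussianEntropy_empty]
    rw [hlam0] at hent
    exact absurd hent (not_lt.2 bot_le)
  have hρnn : 0 ≤ ρ := (norm_nonneg z₀).trans (mem_closedBall_zero_iff.1 (hρ hz₀))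
  have hDnn : 0 ≤ D := le_max_right _ _
  have hKne : Kreg.Nonempty :=
    ⟨((0 : F), ts), mem_closedBall_zero_iff.2 (by rw [norm_zero]; positivity), le_rfl, htb_ts.le⟩
  obtain ⟨p, hpK, hpmax⟩ := hKc.exists_isMaxOn hKne hcont
  have hbound : ∀ (y : F) (t : ℝ), 0 < t → gaussianArea n y t (range f) ≤
      max (gaussianArea n p.1 p.2 (range f)) (ENNReal.ofReal q) := by
    intro y t ht
    by_cases h1 : t ≤ ts
    · exact (hsmall' y t ht h1).trans (le_max_right _ _)
    by_cases h2 : tb ≤ t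
    · exact (hlarge y t h2).trans (le_max_right _ _)
    push Not at h1 h2
    by_cases h3 : ρ + D < ‖y‖
    · exact (hfar y t h1.le h2.le h3).trans (le_max_right _ _)
    · push Not at h3
      have hmem : (y, t) ∈ Kreg := ⟨mem_closedBall_zero_iff.2 h3, h1.le, h2.le⟩
      exact (hpmax hmem).trans (le_max_left _ _)
  have hlam_le : lam ≤ max (gaussianArea n p.1 p.2 (range f)) (ENNReal.ofReal q) := by
    rw [hlam, gaussianEntropy_eq_iSup]
    exact iSup_le fun y => iSup_le fun t => iSup_le fun ht => hbound y t ht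
  have hFp : lam ≤ gaussianArea n p.1 p.2 (range f) := by
    rcases le_max_iff.1 hlam_le with h | h
    · exact h
    · exact absurd h (not_le.2 hqlam)
  have hp2 : 0 < p.2 := hts.trans_le hpK.2.1
  exact ⟨p.1, p.2, hp2, le_antisymm (gaussianArea_le_gaussianEntropy _ _ hp2 _) hFp⟩

end Achieved

end Literature.Geometry.Riemannian

end
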